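import Mathlib
import Literature.MathematicalPhysics.KineticTheory.HardSphereEuler
import Summits.AtomisticToContinuum.FouriersLaw.Theorems.ParityLiouvilleSeedCesaroUpgradeWeakLimit
import HarnessLib

/-!
# Quadratic-test convergence: weak convergence plus second moments
# (`stub_quadraticTestConvergence`, stub S3a of the line `preshock-kinetic-slaving` of the crux
# `JParityClosure.EvenStressEnskog`, stmt-AtomisticToContinuum-13079)

Pure measure theory, the deterministic tool behind "kinetic slaving": let finite measures `μs i` on
`V3 = ℝ³` converge weakly (Mathlib's topology on `MeasureTheory.FiniteMeasure`) to `ν` along an ARBITRARY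
filter `l`, let `‖v‖²` be integrable under every `μs i` and under `ν`, and let the second moments converge,
`∫ ‖v‖² dμs i → ∫ ‖v‖² dν`.  Then `∫ F dμs i → ∫ F dν` for every continuous `F : V3 → ℝ` of quadratic growth
`|F v| ≤ C (1 + ‖v‖²)`.

It is obtained from the general statement `QuadraticTest.tendsto_integral_of_tendsto_integral_dominant`
(a "generalised dominated convergence theorem under weak convergence", on any topological measurable space with
measurable open sets): if `μs i → ν` weakly, `F` and `w` are continuous with `|F| ≤ w`, `w` is integrable under
every `μs i` and under `ν`, and `∫ w dμs i → ∫ w dν`, then `∫ F dμs i → ∫ F dν`.  For the stub,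
`w v = C (1 + ‖v‖²)`, whose integrals converge because masses converge under weak convergence (test function `1`)
and second moments converge by hypothesis.

Proof of the general statement (uniform integrability by clamping).  For a level `L ≥ 0` clamp `F` to
`F_L = max (-L) (min F L)` (the clamp of `FouriersLaw/Theorems/ParityLiouvilleSeedCesaroUpgradeWeakLimit`,
whose bound `CesaroUpgrade.abs_clamp_le` is reused) and `w` to `min w L`; both are bounded continuous, so their
integrals converge by weak convergence (`FiniteMeasure.tendsto_iff_forall_integral_tendsto`).  Pointwise
`|F − F_L| ≤ w − min w L` (`abs_sub_clamp_le_sub_min`), whence for every finite measure `ρ` integrating `w`,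
`|∫ F dρ − ∫ F_L dρ| ≤ T_L(ρ) := ∫ w dρ − ∫ min w L dρ` (`abs_integral_sub_integral_clamp_le`).  Along `l`,
`T_L(μs i) → T_L(ν)`, and `T_L(ν) → 0` as `L → ∞` by dominated convergence under `ν` (majorant `w`).  An `ε/3`
argument concludes; nothing is used about the filter `l` beyond `Tendsto` (it may even be `⊥`).

No definitions.  References: P. Billingsley, *Convergence of Probability Measures* (2nd ed., 1999), Thm. 3.5
(uniform integrability ⇒ convergence of moments); standard. [folklore]
-/

noncomputable section

namespace Summit.AtomisticToContinuum.HydrodynamicLimit.Theorems.EvenStressEnskog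

open scoped Topology ENNReal
open MeasureTheory Filter Set
open Literature.MathematicalPhysics.KineticTheory

namespace QuadraticTest

/-! ## Elementary clamp estimates -/

/-- The clamp error is controlled by the tail of any majorant: if `|t| ≤ s` and `0 ≤ L` then
`|t - max (-L) (min t L)| ≤ s - min s L`. [folklore] -/
theorem abs_sub_clamp_le_sub_min {t s L : ℝ} (hL : 0 ≤ L) (hts : |t| ≤ s) :
    |t - max (-L) (min t L)| ≤ s - min s L := by
  obtain ⟨h1, h2⟩ := abs_le.1 hts
  rw [abs_le]
  rcases le_total t L with htL | htL
  · rw [min_eq_left htL]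
    rcases le_total (-L) t with hLt | hLt
    · rw [max_eq_right hLt]
      constructor <;> linarith [min_le_left s L]
    · rw [max_eq_left hLt, min_eq_right (show L ≤ s by linarith)]
      constructor <;> linarith
  · rw [min_eq_right htL, max_eq_right (show -L ≤ L by linarith),
      min_eq_right (show L ≤ s by linarith)]
    constructor <;> linarith

/-- The `ε/3` bookkeeping: `|a - c| < e` from `|a - b|, |b - d|, |c - d| < e/3`. [folklore] -/
theorem abs_sub_lt_of_thirds {a b c d e : ℝ} (h1 : |a - b| < e / 3) (h2 : |b - d| < e / 3)
    (h3 : |c - d| < e / 3) : |a - c| < e := by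
  have h4 := abs_sub_le a b c
  have h5 := abs_sub_le b d c
  rw [abs_sub_comm d c] at h5
  linarith

/-! ## Bounded test functions under weak convergence of finite measures -/

/-- A (strongly) measurable function with a uniform bound is integrable under a finite measure. [folklore] -/
theorem integrable_of_abs_le {Ω : Type*} [MeasurableSpace Ω] {ρ : Measure Ω} [IsFiniteMeasure ρ]
    {g : Ω → ℝ} (hg : AEStronglyMeasurable g ρ) {B : ℝ} (hB : ∀ x, |g x| ≤ B) : Integrable g ρ :=
  Integrable.of_bound hg B (Eventually.of_forall fun x => by rw [Real.norm_eq_abs]; exact hB x)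

/-- Weak convergence of finite measures tested on a continuous function with a uniform bound (the function
is packaged as a `BoundedContinuousFunction` and fed to
`FiniteMeasure.tendsto_iff_forall_integral_tendsto`). [folklore] -/
theorem tendsto_integral_of_abs_le {Ω : Type*} [MeasurableSpace Ω] [TopologicalSpace Ω]
    [OpensMeasurableSpace Ω] {ι : Type*} {l : Filter ι} {μs : ι → FiniteMeasure Ω}
    {ν : FiniteMeasure Ω} (hμ : Tendsto μs l (𝓝 ν)) {g : Ω → ℝ} (hg : Continuous g) {B : ℝ}
    (hB : ∀ x, |g x| ≤ B) :
    Tendsto (fun i => ∫ x, g x ∂(μs i : Measure Ω)) l (𝓝 (∫ x, g x ∂(ν : Measure Ω))) :=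
  (FiniteMeasure.tendsto_iff_forall_integral_tendsto.1 hμ)
    (BoundedContinuousFunction.ofNormedAddCommGroup g hg B fun x => by
      rw [Real.norm_eq_abs]; exact hB x)

/-! ## The clamping error in `L¹` -/

/-- Clamping error in `L¹`: if `|F| ≤ w` pointwise with `w` integrable under the finite measure `ρ`, then for
`0 ≤ L`, `|∫ F dρ - ∫ max (-L) (min F L) dρ| ≤ ∫ w dρ - ∫ min w L dρ`. [folklore] -/
theorem abs_integral_sub_integral_clamp_le {Ω : Type*} [MeasurableSpace Ω] {ρ : Measure Ω}
    [IsFiniteMeasure ρ] {F w : Ω → ℝ} (hFm : AEStronglyMeasurable F ρ) (hw : Integrable w ρ)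
    (hFw : ∀ x, |F x| ≤ w x) {L : ℝ} (hL : 0 ≤ L) :
    |∫ x, F x ∂ρ - ∫ x, max (-L) (min (F x) L) ∂ρ| ≤ ∫ x, w x ∂ρ - ∫ x, min (w x) L ∂ρ := by
  have hw0 : ∀ x, 0 ≤ w x := fun x => (abs_nonneg _).trans (hFw x)
  have hFi : Integrable F ρ :=
    hw.mono' hFm (Eventually.of_forall fun x => by rw [Real.norm_eq_abs]; exact hFw x)
  have hcl : Integrable (fun x => max (-L) (min (F x) L)) ρ :=
    integrable_of_abs_le
      (aemeasurable_const.max (hFm.aemeasurable.min aemeasurable_const)).aestronglyMeasurable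
      fun x => FouriersLaw.Theorems.CesaroUpgrade.abs_clamp_le hL (F x)
  have hmin : Integrable (fun x => min (w x) L) ρ :=
    integrable_of_abs_le (hw.aemeasurable.min aemeasurable_const).aestronglyMeasurable
      fun x => by rw [abs_of_nonneg (le_min (hw0 x) hL)]; exact min_le_right _ _
  rw [← integral_sub hFi hcl, ← integral_sub hw hmin]
  calc |∫ x, F x - max (-L) (min (F x) L) ∂ρ| ≤ ∫ x, |F x - max (-L) (min (F x) L)| ∂ρ :=
        abs_integral_le_integral_abs
    _ ≤ ∫ x, w x - min (w x) L ∂ρ :=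
        integral_mono (hFi.sub hcl).abs (hw.sub hmin) fun x => abs_sub_clamp_le_sub_min hL (hFw x)

/-! ## Generalised dominated convergence under weak convergence -/

/-- **Generalised dominated convergence under weak convergence of finite measures.**  On a topological space
with measurable open sets, let `μs i → ν` weakly along a filter `l`, let `F`, `w` be continuous with `|F| ≤ w`,
`w` integrable under every `μs i` and under `ν`, and `∫ w dμs i → ∫ w dν`.  Then `∫ F dμs i → ∫ F dν`.
(Clamp at level `L`: the clamped integrals converge by weak convergence, the clamping errors are bounded by
`∫ w − ∫ min w L` on both sides, which converges along `l` and is small at the limit for large `L` by dominated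
convergence; `ε/3`.) [folklore] -/
theorem tendsto_integral_of_tendsto_integral_dominant {Ω : Type*} [MeasurableSpace Ω]
    [TopologicalSpace Ω] [OpensMeasurableSpace Ω] {ι : Type*} {l : Filter ι}
    {μs : ι → FiniteMeasure Ω} {ν : FiniteMeasure Ω} (hμ : Tendsto μs l (𝓝 ν)) {F w : Ω → ℝ}
    (hF : Continuous F) (hw : Continuous w) (hFw : ∀ x, |F x| ≤ w x)
    (hwi : ∀ i, Integrable w (μs i : Measure Ω)) (hwν : Integrable w (ν : Measure Ω))
    (hwt : Tendsto (fun i => ∫ x, w x ∂(μs i : Measure Ω)) l (𝓝 (∫ x, w x ∂(ν : Measure Ω)))) :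
    Tendsto (fun i => ∫ x, F x ∂(μs i : Measure Ω)) l (𝓝 (∫ x, F x ∂(ν : Measure Ω))) := by
  have hw0 : ∀ x, 0 ≤ w x := fun x => (abs_nonneg _).trans (hFw x)
  -- the clamping error of the limit tends to zero (dominated convergence under `ν`)
  have hdct : Tendsto (fun n : ℕ => ∫ x, min (w x) (n : ℝ) ∂(ν : Measure Ω)) atTop
      (𝓝 (∫ x, w x ∂(ν : Measure Ω))) := by
    refine tendsto_integral_of_dominated_convergence (F := fun (n : ℕ) x => min (w x) (n : ℝ))
      (f := w) w (fun n => (hw.min continuous_const).aestronglyMeasurable) hwν (fun n => ?_) ?_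
    · exact Eventually.of_forall fun x => by
        rw [Real.norm_eq_abs, abs_of_nonneg (le_min (hw0 x) (Nat.cast_nonneg n))]
        exact min_le_left _ _
    · refine Eventually.of_forall fun x => tendsto_const_nhds.congr' ?_
      filter_upwards [eventually_ge_atTop ⌈w x⌉₊] with n hn
      rw [min_eq_left ((Nat.le_ceil _).trans (by exact_mod_cast hn))]
  have hT0 : Tendsto (fun n : ℕ => ∫ x, w x ∂(ν : Measure Ω) - ∫ x, min (w x) (n : ℝ) ∂(ν : Measure Ω))
      atTop (𝓝 0) := by
    have := hdct.const_sub (∫ x, w x ∂(ν : Measure Ω))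
    rwa [sub_self] at this
  rw [Metric.tendsto_nhds]
  intro ε hε
  have hε3 : 0 < ε / 3 := by positivity
  -- choose the clamp level `n`
  obtain ⟨n, hn⟩ := ((Metric.tendsto_nhds.1 hT0) (ε / 3) hε3).exists
  rw [Real.dist_0_eq_abs] at hn
  have hL : (0 : ℝ) ≤ n := Nat.cast_nonneg n
  have hTν : ∫ x, w x ∂(ν : Measure Ω) - ∫ x, min (w x) (n : ℝ) ∂(ν : Measure Ω) < ε / 3 :=
    (le_abs_self _).trans_lt hn
  -- the clamped integrals and the clamping errors converge along `l`
  have hmin : Tendsto (fun i => ∫ x, min (w x) (n : ℝ) ∂(μs i : Measure Ω)) l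
      (𝓝 (∫ x, min (w x) (n : ℝ) ∂(ν : Measure Ω))) :=
    tendsto_integral_of_abs_le hμ (hw.min continuous_const)
      fun x => by rw [abs_of_nonneg (le_min (hw0 x) hL)]; exact min_le_right _ _
  have hcl : Tendsto (fun i => ∫ x, max (-(n : ℝ)) (min (F x) n) ∂(μs i : Measure Ω)) l
      (𝓝 (∫ x, max (-(n : ℝ)) (min (F x) n) ∂(ν : Measure Ω))) :=
    tendsto_integral_of_abs_le hμ (continuous_const.max (hF.min continuous_const))
      fun x => FouriersLaw.Theorems.CesaroUpgrade.abs_clamp_le hL (F x)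
  have hev1 := (hwt.sub hmin).eventually_lt_const hTν
  have hev2 := Metric.tendsto_nhds.1 hcl (ε / 3) hε3
  filter_upwards [hev1, hev2] with i hi1 hi2
  rw [Real.dist_eq] at hi2 ⊢
  have hA := abs_integral_sub_integral_clamp_le (ρ := (μs i : Measure Ω)) hF.aestronglyMeasurable
    (hwi i) hFw hL
  have hB := abs_integral_sub_integral_clamp_le (ρ := (ν : Measure Ω)) hF.aestronglyMeasurable
    hwν hFw hL
  exact abs_sub_lt_of_thirds (hA.trans_lt hi1) hi2 (hB.trans_lt hTν)

end QuadraticTest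

/-! ## The registered stub -/

/-- **S3a · QUADRATIC-TEST CONVERGENCE** (registered stub `stub_quadraticTestConvergence` of the line
`preshock-kinetic-slaving`, crux `JParityClosure.EvenStressEnskog`): weak convergence of finite measures on
`V3 = ℝ³` along an arbitrary filter, together with integrability and convergence of the second moments
`∫ ‖v‖²`, upgrades to convergence of `∫ F` for every continuous test function of quadratic growth
`|F v| ≤ C (1 + ‖v‖²)` — the instance `w v = C (1 + ‖v‖²)` of
`QuadraticTest.tendsto_integral_of_tendsto_integral_dominant` (masses converge under weak convergence, second
moments by hypothesis). [folklore] -/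
theorem stub_quadraticTestConvergence :
    ∀ {ι : Type} (l : Filter ι) (μs : ι → FiniteMeasure V3) (ν : FiniteMeasure V3),
    Tendsto μs l (𝓝 ν) →
    (∀ i, Integrable (fun v : V3 => ‖v‖ ^ 2) (μs i : Measure V3)) →
    Integrable (fun v : V3 => ‖v‖ ^ 2) (ν : Measure V3) →
    Tendsto (fun i => ∫ v, ‖v‖ ^ 2 ∂(μs i : Measure V3)) l (𝓝 (∫ v, ‖v‖ ^ 2 ∂(ν : Measure V3))) →
    ∀ F : V3 → ℝ, Continuous F → (∃ C : ℝ, ∀ v, |F v| ≤ C * (1 + ‖v‖ ^ 2)) →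
      Tendsto (fun i => ∫ v, F v ∂(μs i : Measure V3)) l (𝓝 (∫ v, F v ∂(ν : Measure V3))) := by
  intro ι l μs ν hμ h2i h2 hm F hF hC
  obtain ⟨C, hC⟩ := hC
  -- the weight `w v = C (1 + ‖v‖²)`: integrability and the value of its integral
  have hwi : ∀ (ρ : Measure V3) [IsFiniteMeasure ρ], Integrable (fun v : V3 => ‖v‖ ^ 2) ρ →
      Integrable (fun v : V3 => C * (1 + ‖v‖ ^ 2)) ρ :=
    fun ρ _ hρ => ((integrable_const (1 : ℝ)).add hρ).const_mul C
  have hw_eq : ∀ (ρ : Measure V3) [IsFiniteMeasure ρ], Integrable (fun v : V3 => ‖v‖ ^ 2) ρ →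
      ∫ v, C * (1 + ‖v‖ ^ 2) ∂ρ = C * (ρ.real univ + ∫ v, ‖v‖ ^ 2 ∂ρ) := by
    intro ρ _ hρ
    rw [integral_const_mul, integral_add (integrable_const _) hρ, integral_const, smul_eq_mul, mul_one]
  -- masses converge (test function `1`), hence so do the integrals of the weight
  have hmass : Tendsto (fun i => (μs i : Measure V3).real univ) l (𝓝 ((ν : Measure V3).real univ)) := by
    have h1 := QuadraticTest.tendsto_integral_of_abs_le hμ (g := fun _ : V3 => (1 : ℝ))
      continuous_const (B := 1) fun _ => by norm_num
    simpa only [integral_const, smul_eq_mul, mul_one] using h1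
  have hwt : Tendsto (fun i => ∫ v, C * (1 + ‖v‖ ^ 2) ∂(μs i : Measure V3)) l
      (𝓝 (∫ v, C * (1 + ‖v‖ ^ 2) ∂(ν : Measure V3))) := by
    rw [hw_eq _ h2]
    exact ((hmass.add hm).const_mul C).congr fun i => (hw_eq _ (h2i i)).symm
  exact QuadraticTest.tendsto_integral_of_tendsto_integral_dominant (w := fun v : V3 => C * (1 + ‖v‖ ^ 2))
    hμ hF (by fun_prop) hC (fun i => hwi _ (h2i i)) (hwi _ h2) hwt

end Summit.AtomisticToContinuum.HydrodynamicLimit.Theorems.EvenStressEnskog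

end
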